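import Literature.NumberTheory.LFunctions.KMVCentralValueSquaredAFE
import Literature.NumberTheory.LFunctions.GL2CentralValueBridge
import HarnessLib

/-!
# KMV 2000 (21)–(22) at `k = 0`, proof file I: `Λ(f, ½) = 2π q̂^{1/2} ∫_0^∞ f(iy) dy`
# (stub S1 of the fact skeleton `fricke-real-split` for `KMV2000.completedL_half_sq_eq`)

Source: E. Kowalski, P. Michel, J. VanderKam, J. reine angew. Math. 526 (2000), p. 1 (definition
`Λ(f,s) = q̂^s Γ(s+½) L(f,s)`, `q̂ = √q/2π`) and (13) p. 9 [held: paper:doi-10-1515-crll-2000-074].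
Cell landau-siegel / ls-inputs, seat ls-inputs-Hafe-lead g0, K-INPUTS-7 (3).

`KMV2000.completedL N f s = q̂^s Γ(s+½) E(s+½)` with `E = IwaniecSarnak.entireLSeries (cuspCoeff f) 2`
the entire continuation of record of `Σ a_n n^{-s}`; by `GL2Family.entireLSeries_cuspCoeff_eq_cuspFormLStar`
`E = L^*(f,·) = (2π)^s Γ(s)⁻¹ ∫_0^∞ f(iy) y^{s-1} dy`, so at `s = ½`: `Λ(f,½) = q̂^{1/2}·Γ(1)·2π·∫_0^∞ f(iy) dy`.
Valid at every level `N ≥ 1` and for every `f ∈ S₂(Γ₀(N))`. No named fact is used.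
-/

noncomputable section

open scoped Real
open Complex Set MeasureTheory CongruenceSubgroup
open Literature.NumberTheory.EllipticCurves.ModularForms

namespace Literature.NumberTheory.LFunctions.KMV2000

/-- **`Λ(f, ½) = 2π · q̂^{1/2} · ∫_0^∞ f(iy) dy`** for `f ∈ S₂(Γ₀(N))` (KMV's completed `L`-function at
the centre is `2π q̂^{1/2}` times the period `∫_0^∞ f(iy) dy`: `Γ(1) = 1` and `L^*(f, 1) = 2π ∫_0^∞ f(iy) dy`).
[cite: KowalskiMichelVanderKam2000, §1 p. 1 (definition of Λ) and (13) p. 9] -/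
theorem completedL_half_eq_integral {N : ℕ} [NeZero N] (f : CuspForm (Gamma0 N) 2) :
    completedL N f (1 / 2) =
      2 * (π : ℂ) * ((qhat N : ℝ) : ℂ) ^ (1 / 2 : ℂ) *
        ∫ y in Ioi (0 : ℝ), f (UpperHalfPlane.ofComplex (Complex.I * y)) := by
  have h := GL2Family.entireLSeries_cuspCoeff_eq_cuspFormLStar f
  norm_num at h
  have h12 : (1 : ℂ) / 2 + 1 / 2 = 1 := by norm_num
  rw [completedL, h12, Complex.Gamma_one, mul_one, h, GL2Family.cuspFormLStar_def, Complex.Gamma_one,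
    div_one, cpow_one, GL2Family.cuspFormMellin_def, mellin]
  have hint : ∫ t in Ioi (0 : ℝ), (t : ℂ) ^ ((1 : ℂ) - 1) • f (UpperHalfPlane.ofComplex (Complex.I * t)) =
      ∫ t in Ioi (0 : ℝ), f (UpperHalfPlane.ofComplex (Complex.I * t)) :=
    setIntegral_congr_fun measurableSet_Ioi fun t _ ↦ by simp
  rw [hint]
  ring

/-- Stub **S1** of the fact skeleton `fricke-real-split` (crux workfile
`Cruxes/BeyondDiagonalBeatsQuarter/Lines/fricke_real_split.lean` on stmt-Parity-20343), in its registered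
quantifier shape. [cite: KowalskiMichelVanderKam2000, §1 p. 1 (definition of Λ)] -/
theorem completedL_half_eq_integral_all :
    ∀ (N : ℕ) [NeZero N] (f : CuspForm (Gamma0 N) 2),
      completedL N f (1 / 2) =
        2 * (π : ℂ) * ((qhat N : ℝ) : ℂ) ^ (1 / 2 : ℂ) *
          ∫ y in Ioi (0 : ℝ), f (UpperHalfPlane.ofComplex (Complex.I * y)) :=
  fun _ _ f ↦ completedL_half_eq_integral f

end Literature.NumberTheory.LFunctions.KMV2000

end
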